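import Summits.Ventures.Crystal3D.Bulk.GapActiveFaces
import HarnessLib

/-!
# The two sides of every tight edge are DISTINCT oriented faces (no pinched / bridge-like edge;
# route 1 of `HOME/lean/lemmaL/DESIGN.md`, consequence of LEMMA L)

HONEST FRAMING. Part of the venture `Summits/Ventures/Crystal3D` (cell `pub-crystal3d`, phase 2;
seat p3). Kernel theorem about every configuration satisfying `CensusRows c`; nothing is claimed
about GAP(1.26). In the census's plane-map model every edge of the tight graph `T′` borders two
DIFFERENT faces (simple face boundaries, classes `-c2`/`-c3`). Here: for every dart `q = (i, j)`
of the tight map, the reversed dart `(j, i)` does NOT lie on the oriented face of `q` — because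
the face walk of `q` has pairwise distinct vertices (`CensusRows.fst_iterate_ofaceSucc_injOn`,
LEMMA L) and its second dart already starts at `j` while being different from `(j, i)` (the
oriented successor `onextNbr c j i ≠ i`, degree `≥ 3`):

* **`CensusRows.swap_not_mem_ofaceOf`** — `q.swap ∉ ofaceOf c q`;
* **`CensusRows.ofaceOf_swap_ne`** — `ofaceOf c q.swap ≠ ofaceOf c q`.
-/

noncomputable section

namespace Summit.Ventures.Crystal3D

open Literature.Geometry.DiscreteGeometry Finset Function

variable {c : Fin 14 → EuclideanSpace ℝ (Fin 3)}

/-- **The reversed dart is not on the face**: for a dart `q` of the tight map of a census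
configuration, `q.swap ∉ ofaceOf c q`. -/
theorem CensusRows.swap_not_mem_ofaceOf (h : CensusRows c) {q : Fin 14 × Fin 14} (hq : q ∈ darts c) :
    q.swap ∉ ofaceOf c q := by
  intro hmem
  obtain ⟨hD3, -, -⟩ := h.intruderDist_bounds
  have hper := h.isGapConfig.mem_periodicPts_ofaceSucc hD3 hq
  obtain ⟨n, hn⟩ := (mem_ofaceOf_iff hper).1 hmem
  set m := ofaceLen c q with hm
  have hmpos : 0 < m := h.isGapConfig.ofaceLen_pos hD3 hq
  -- reduce the exponent below the period
  set t := n % m with ht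
  have htm : t < m := Nat.mod_lt _ hmpos
  have htq : (ofaceSucc c)^[t] q = q.swap := by
    rw [ht, hm]; unfold ofaceLen; rw [iterate_mod_minimalPeriod_eq]; exact hn
  obtain ⟨hi0, hj0, hij, -⟩ := mem_darts.1 hq
  -- `t ≠ 0`: `q ≠ q.swap`
  have ht0 : t ≠ 0 := by
    intro h0
    rw [h0, iterate_zero, id_eq] at htq
    exact hij (by have := congrArg Prod.fst htq; simpa using this)
  -- `t ≠ 1`: `φ° q = (j, onextNbr c j i) ≠ (j, i)`
  have ht1 : t ≠ 1 := by
    intro h1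
    rw [h1, iterate_one] at htq
    have hi : q.1 ∈ tightNbrs c q.2 := by
      have := snd_mem_tightNbrs_of_mem_darts (swap_mem_darts hq)
      simpa only [Prod.fst_swap, Prod.snd_swap] using this
    have hne := (h.onextNbr_mem_ne hj0 hi).2
    have h2 := congrArg Prod.snd htq
    simp only [ofaceSucc, Prod.snd_swap] at h2
    exact hne h2
  -- positions `1` and `t` both start at `j`
  have e1 : ((ofaceSucc c)^[1] q).1 = q.2 := by rw [iterate_one]; rfl
  have et : ((ofaceSucc c)^[t] q).1 = q.2 := by rw [htq]; rfl
  exact h.fst_iterate_ofaceSucc_injOn hq (show 1 < t by omega) htm (by rw [e1, et])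

/-- **The two sides of a tight edge are distinct oriented faces.** -/
theorem CensusRows.ofaceOf_swap_ne (h : CensusRows c) {q : Fin 14 × Fin 14} (hq : q ∈ darts c) :
    ofaceOf c q.swap ≠ ofaceOf c q := by
  intro heq
  obtain ⟨hD3, -, -⟩ := h.intruderDist_bounds
  have hmem : q.swap ∈ ofaceOf c q := by
    rw [← heq]
    exact self_mem_ofaceOf (h.isGapConfig.mem_periodicPts_ofaceSucc hD3 (swap_mem_darts hq))
  exact h.swap_not_mem_ofaceOf hq hmem

end Summit.Ventures.Crystal3D
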